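import Mathlib
import Summits.ResolutionOfSingularities.ResolutionOfSingularities.Theses.EscapeRate

/-!
# `LinearCodimGrowth` — negative lemma: an eternal persistence family of bounded codimension

Support (negative-side) lemma for crux `stmt-ResolutionOfSingularities-18128`
(`Summit.ResolutionOfSingularities.ResolutionOfSingularities.Theses.EscapeRate.LinearCodimGrowth`),
used by `Theorems/EscapeRateLinearCodimGrowthRefutation.lean`.  This file declares NO definition
(the `let`-bound point-blow-up dynamics of the route file is written out verbatim, at
`p = n = 2`) and NO declaration concludes a route decl positively.

`eternal_family`: for every field `κ` with finitely many elements (`q`), every `N` and every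
`M ≥ 5` there is a family `F` of starts `c₀ : (Fin 2 → ℕ) → κ`, supported in degrees `≤ M`
(`Supp`) and persisting `N` steps (`Persist`, verbatim from the statement), with
`q ^ C(M+2,2) ≤ |F| · q ^ 17` — i.e. codimension `≤ 17`, INDEPENDENT of `N`.  Mechanism: take all
starts whose non-zero coefficients sit in degrees `4 … M` with the coefficient of `x⁵` equal to
`1`; along the word `x`-chart, `y`-chart, `y`-chart, … with all translations `0`, after one
blow-up the state is `x² · b` (the exceptional line `x = 0` is a curve of double points of
`z² = x² b`), every later state keeps all `x`-exponents `≥ 2` (cleaned order `≥ 2`) and the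
tracked monomial `x⁵ ↦ x³ ↦ x³y ↦ x³y² ↦ …` (odd `x`-exponent) is never cleaned.
-/

set_option linter.dupNamespace false -- mandated namespace of this single-conjunct summit

namespace Summit.ResolutionOfSingularities.ResolutionOfSingularities.Theorems.LinearCodimGrowth.Negative

open scoped BigOperators Classical

/-- **Eternal family.** With the point-blow-up dynamics of `EscapeRate.LinearCodimGrowth` at
`p = n = 2` (verbatim), for every `N` and `M ≥ 5` there is a family `F` of starts over `κ`,
supported in degrees `≤ M` and persisting `N` steps (translations in the algebraic closure, in
fact all `0`), with `q ^ C(M+2,2) ≤ |F| · q ^ 17`: the `N`-step persistence locus has codimension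
`≤ 17` for every `N`.  [folklore] -/
theorem eternal_family (κ : Type) [Field κ] [Fintype κ] (N M : ℕ) (hM : 5 ≤ M) :
    let L := AlgebraicClosure κ
    let clean : ((Fin 2 → ℕ) → L) → ((Fin 2 → ℕ) → L) :=
      fun c A => @ite L (∀ j, 2 ∣ A j) (Classical.dec _) 0 (c A)
    let bl : Fin 2 → ((Fin 2 → ℕ) → L) → ((Fin 2 → ℕ) → L) := fun i c B =>
      @ite L (Finset.sum (Finset.univ.erase i) (fun j => B j) ≤ B i) (Classical.dec _)
        (c (Function.update B i (B i - Finset.sum (Finset.univ.erase i) (fun j => B j)))) 0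
    let ord : ((Fin 2 → ℕ) → L) → ℕ :=
      fun c => sInf {m : ℕ | ∃ A, c A ≠ 0 ∧ m = Finset.sum Finset.univ (fun j => A j)}
    let dv : Fin 2 → ℕ → ((Fin 2 → ℕ) → L) → ((Fin 2 → ℕ) → L) :=
      fun i s c B => c (Function.update B i (B i + s))
    let tr : Fin 2 → (Fin 2 → L) → ℕ → ((Fin 2 → ℕ) → L) → ((Fin 2 → ℕ) → L) :=
      fun i τ s c B => Finset.sum (Fintype.piFinset (fun _ : Fin 2 => Finset.range (B i + s + 1)))
        (fun D => @ite L (D i = 0) (Classical.dec _) (c (B + D) *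
          Finset.prod (Finset.univ.erase i)
            (fun j => ((Nat.choose (B j + D j) (B j) : ℕ) : L) * τ j ^ (D j))) 0)
    let step : Fin 2 → (Fin 2 → L) → ((Fin 2 → ℕ) → L) → ((Fin 2 → ℕ) → L) :=
      fun i τ c => clean (tr i τ (@ite ℕ (2 ≤ ord (clean c)) (Classical.dec _) 2 0)
        (dv i (@ite ℕ (2 ≤ ord (clean c)) (Classical.dec _) 2 0) (bl i (clean c))))
    let run : ((Fin 2 → ℕ) → L) → (ℕ → Fin 2) → (ℕ → Fin 2 → L) → ℕ → ((Fin 2 → ℕ) → L) :=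
      fun c₀ i t m => @Nat.rec (fun _ => (Fin 2 → ℕ) → L) c₀ (fun m c => step (i m) (t m) c) m
    let MultP : ((Fin 2 → ℕ) → L) → Prop := fun c =>
      (∃ A, clean c A ≠ 0) ∧ ∀ A, clean c A ≠ 0 → 2 ≤ Finset.sum Finset.univ (fun j => A j)
    let Persist : ((Fin 2 → ℕ) → κ) → Prop := fun c₀ =>
      ∃ (i : ℕ → Fin 2) (t : ℕ → Fin 2 → L), ∀ m, m ≤ N →
        MultP (run (fun A => algebraMap κ L (c₀ A)) i t m)
    let Supp : ((Fin 2 → ℕ) → κ) → Prop :=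
      fun c₀ => ∀ A : Fin 2 → ℕ, M < Finset.sum Finset.univ (fun j => A j) → c₀ A = 0
    ∃ F : Finset ((Fin 2 → ℕ) → κ), (∀ c₀ ∈ F, Supp c₀ ∧ Persist c₀) ∧
      Fintype.card κ ^ Nat.choose (M + 2) 2 ≤ F.card * Fintype.card κ ^ 17 := by
  intro L clean bl ord dv tr step run MultP Persist Supp
  /- ### Evaluation of the dynamics (equation lemmas of the `let`s) -/
  have clean_of_not : ∀ (c : (Fin 2 → ℕ) → L) (A : Fin 2 → ℕ), (¬ ∀ j, 2 ∣ A j) →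
      clean c A = c A := fun c A h => if_neg h
  have clean_ne : ∀ (c : (Fin 2 → ℕ) → L) (A : Fin 2 → ℕ), clean c A ≠ 0 →
      (¬ ∀ j, 2 ∣ A j) ∧ c A ≠ 0 := by
    intro c A h
    by_cases hA : ∀ j, 2 ∣ A j
    · exact absurd (if_pos hA) h
    · exact ⟨hA, by rwa [clean_of_not c A hA] at h⟩
  have le_ord : ∀ (c : (Fin 2 → ℕ) → L) (k : ℕ), (∃ A, c A ≠ 0) →
      (∀ A, c A ≠ 0 → k ≤ Finset.sum Finset.univ (fun j => A j)) → k ≤ ord c := by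
    intro c k hne hall
    obtain ⟨A₀, hA₀⟩ := hne
    have hS : ({m : ℕ | ∃ A, c A ≠ 0 ∧ m = Finset.sum Finset.univ (fun j => A j)}).Nonempty :=
      ⟨_, A₀, hA₀, rfl⟩
    obtain ⟨A, hA, hm⟩ := Nat.sInf_mem hS
    show k ≤ sInf _
    rw [hm]
    exact hall A hA
  have step_of_le : ∀ (i : Fin 2) (τ : Fin 2 → L) (c : (Fin 2 → ℕ) → L), 2 ≤ ord (clean c) →
      step i τ c = clean (tr i τ 2 (dv i 2 (bl i (clean c)))) := by
    intro i τ c h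
    show clean (tr i τ (@ite ℕ (2 ≤ ord (clean c)) (Classical.dec _) 2 0)
      (dv i (@ite ℕ (2 ≤ ord (clean c)) (Classical.dec _) 2 0) (bl i (clean c)))) = _
    rw [if_pos h]
  have run_succ : ∀ (c₀ : (Fin 2 → ℕ) → L) (i : ℕ → Fin 2) (t : ℕ → Fin 2 → L) (m : ℕ),
      run c₀ i t (m + 1) = step (i m) (t m) (run c₀ i t m) := fun _ _ _ _ => rfl
  have tr_zero : ∀ (i : Fin 2) (s : ℕ) (c : (Fin 2 → ℕ) → L) (B : Fin 2 → ℕ),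
      tr i (fun _ => 0) s c B = c B := by
    intro i s c B
    show Finset.sum _ _ = _
    rw [Finset.sum_eq_single (0 : Fin 2 → ℕ)]
    · simp
    · intro D _ hD
      by_cases hDi : D i = 0
      · rw [if_pos hDi]
        obtain ⟨j, hj⟩ : ∃ j, D j ≠ 0 := by
          by_contra hcon
          push Not at hcon
          exact hD (funext hcon)
        have hji : j ≠ i := fun e => hj (e ▸ hDi)
        rw [Finset.prod_eq_zero (Finset.mem_erase.2 ⟨hji, Finset.mem_univ j⟩)]
        · simp
        · simp [zero_pow hj]
      · rw [if_neg hDi]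
    · intro h0
      exact absurd (Fintype.mem_piFinset.2 fun j => by simp) h0
  /- ### The two charts: `i` the chart, `j` the other index -/
  have bl_ne : ∀ {i j : Fin 2}, Finset.univ.erase i = {j} → ∀ (c : (Fin 2 → ℕ) → L)
      (B : Fin 2 → ℕ), bl i c B ≠ 0 → B j ≤ B i ∧ c (Function.update B i (B i - B j)) ≠ 0 := by
    intro i j hij c B h
    change @ite L _ (Classical.dec _) _ 0 ≠ 0 at h
    rw [hij, Finset.sum_singleton] at h
    by_cases hle : B j ≤ B i
    · rw [if_pos hle] at h; exact ⟨hle, h⟩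
    · rw [if_neg hle] at h; exact absurd rfl h
  have bl_of_le : ∀ {i j : Fin 2}, Finset.univ.erase i = {j} → ∀ (c : (Fin 2 → ℕ) → L)
      (B : Fin 2 → ℕ), B j ≤ B i → bl i c B = c (Function.update B i (B i - B j)) := by
    intro i j hij c B hle
    change @ite L _ (Classical.dec _) _ 0 = _
    rw [hij, Finset.sum_singleton, if_pos hle]
  have step_ne : ∀ {i j : Fin 2}, Finset.univ.erase i = {j} → j ≠ i →
      ∀ (c : (Fin 2 → ℕ) → L), 2 ≤ ord (clean c) → ∀ (B : Fin 2 → ℕ),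
      step i (fun _ => 0) c B ≠ 0 → B j ≤ B i + 2 ∧ c (Function.update B i (B i + 2 - B j)) ≠ 0 := by
    intro i j hij hji c hord B h
    rw [step_of_le i _ c hord] at h
    obtain ⟨-, h⟩ := clean_ne _ _ h
    rw [tr_zero] at h
    change bl i (clean c) (Function.update B i (B i + 2)) ≠ 0 at h
    obtain ⟨hle, h⟩ := bl_ne hij _ _ h
    simp only [Function.update_idem, Function.update_apply, if_true, hji, if_false] at hle h
    exact ⟨hle, (clean_ne _ _ h).2⟩
  have step_at : ∀ {i j : Fin 2}, Finset.univ.erase i = {j} → j ≠ i →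
      ∀ (c : (Fin 2 → ℕ) → L), 2 ≤ ord (clean c) → ∀ (B : Fin 2 → ℕ), (¬ ∀ k, 2 ∣ B k) →
      B j ≤ B i + 2 → step i (fun _ => 0) c B = clean c (Function.update B i (B i + 2 - B j)) := by
    intro i j hij hji c hord B hB hle
    rw [step_of_le i _ c hord, clean_of_not _ _ hB, tr_zero]
    change bl i (clean c) (Function.update B i (B i + 2)) = _
    rw [bl_of_le hij _ _ (by simpa [Function.update_apply, hji] using hle)]
    simp only [Function.update_idem, Function.update_apply, if_true, hji, if_false]
  have not_all_even : ∀ {a b : ℕ}, ¬ 2 ∣ a → ¬ ∀ k : Fin 2, 2 ∣ (![a, b] : Fin 2 → ℕ) k :=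
    fun ha h => ha (by simpa using h 0)
  /- ### The invariant along the word `x, y, y, …` with translations `0` -/
  have multP_of_inv : ∀ (c : (Fin 2 → ℕ) → L), (∀ B, c B ≠ 0 → 2 ≤ B 0) → ∀ (A₀ : Fin 2 → ℕ),
      c A₀ ≠ 0 → (¬ ∀ k, 2 ∣ A₀ k) → MultP c ∧ 2 ≤ ord (clean c) := by
    intro c hB A₀ hne hA₀
    have hall : ∀ A, clean c A ≠ 0 → 2 ≤ Finset.sum Finset.univ (fun j => A j) := by
      intro A hA
      have := hB A (clean_ne _ _ hA).2
      simp only [Fin.sum_univ_two]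
      omega
    have hex : ∃ A, clean c A ≠ 0 := ⟨A₀, by rwa [clean_of_not _ _ hA₀]⟩
    exact ⟨⟨hex, hall⟩, le_ord _ _ hex hall⟩
  let word : ℕ → Fin 2 := fun m => if m = 0 then 0 else 1
  have invariant : ∀ (c₀ : (Fin 2 → ℕ) → L), (∀ A, c₀ A ≠ 0 → 4 ≤ A 0 + A 1) →
      c₀ ![5, 0] ≠ 0 → ∀ m : ℕ, (∀ B, run c₀ word (fun _ _ => 0) (m + 1) B ≠ 0 → 2 ≤ B 0) ∧
        run c₀ word (fun _ _ => 0) (m + 1) ![3, m] ≠ 0 := by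
    intro c₀ h1 h2 m
    have e0 : Finset.univ.erase (0 : Fin 2) = {1} := by decide
    have e1 : Finset.univ.erase (1 : Fin 2) = {0} := by decide
    induction m with
    | zero =>
      have hord : 2 ≤ ord (clean c₀) := by
        refine le_ord _ _ ⟨![5, 0], by rwa [clean_of_not _ _ (not_all_even (by decide))]⟩ ?_
        intro A hA
        have := h1 A (clean_ne _ _ hA).2
        simp only [Fin.sum_univ_two]
        omega
      rw [run_succ, show word 0 = 0 from rfl, show run c₀ word (fun _ _ => 0) 0 = c₀ from rfl]
      refine ⟨fun B hB => ?_, ?_⟩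
      · obtain ⟨hle, hc⟩ := step_ne e0 one_ne_zero c₀ hord B hB
        have := h1 _ hc
        simp only [Function.update_apply, if_true, one_ne_zero, if_false] at this
        omega
      · have hu : Function.update (![3, 0] : Fin 2 → ℕ) 0 ((![3, 0] : Fin 2 → ℕ) 0 + 2 - ![3, 0] 1)
            = ![5, 0] := by ext k; fin_cases k <;> simp
        rw [step_at e0 one_ne_zero c₀ hord ![3, 0] (not_all_even (by decide)) (by simp), hu,
          clean_of_not _ _ (not_all_even (by decide))]
        exact h2
    | succ k ih =>
      obtain ⟨ihB, ihne⟩ := ih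
      have hord := (multP_of_inv _ ihB _ ihne (not_all_even (by decide))).2
      rw [run_succ, show word (k + 1) = 1 from rfl]
      refine ⟨fun B hB => ?_, ?_⟩
      · obtain ⟨-, hc⟩ := step_ne e1 zero_ne_one _ hord B hB
        simpa using ihB _ hc
      · have hu : Function.update (![3, k + 1] : Fin 2 → ℕ) 1 ((![3, k + 1] : Fin 2 → ℕ) 1 + 2 -
            ![3, k + 1] 0) = ![3, k] := by ext l; fin_cases l <;> simp
        rw [step_at e1 zero_ne_one _ hord ![3, k + 1] (not_all_even (by decide)) (by simp), hu,
          clean_of_not _ _ (not_all_even (by decide))]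
        exact ihne
  have multP_run : ∀ (c₀ : (Fin 2 → ℕ) → L), (∀ A, c₀ A ≠ 0 → 4 ≤ A 0 + A 1) →
      c₀ ![5, 0] ≠ 0 → ∀ m : ℕ, MultP (run c₀ word (fun _ _ => 0) m) := by
    intro c₀ h1 h2 m
    cases m with
    | zero =>
      refine ⟨⟨![5, 0], by rwa [clean_of_not _ _ (not_all_even (by decide))]⟩, fun A hA => ?_⟩
      have := h1 A (clean_ne _ _ hA).2
      simp only [Fin.sum_univ_two]
      omega
    | succ k =>
      obtain ⟨hB, hne⟩ := invariant c₀ h1 h2 k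
      exact (multP_of_inv _ hB _ hne (not_all_even (by decide))).1
  /- ### Counting: exponents of degree `≤ M`, the free ones, the family -/
  have vec_inj : Function.Injective (fun x : ℕ × ℕ => (![x.1, x.2] : Fin 2 → ℕ)) := by
    intro x y h
    have h0 := congrFun h 0
    have h1 := congrFun h 1
    simp at h0 h1
    exact Prod.ext h0 h1
  set T : Finset (Fin 2 → ℕ) := ((Finset.range (M + 1)).biUnion fun s =>
    Finset.HasAntidiagonal.antidiagonal s).map ⟨_, vec_inj⟩ with hT
  have mem_T : ∀ A : Fin 2 → ℕ, A ∈ T ↔ A 0 + A 1 ≤ M := by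
    intro A
    simp only [hT, Finset.mem_map, Finset.mem_biUnion, Finset.mem_range,
      Finset.HasAntidiagonal.mem_antidiagonal, Function.Embedding.coeFn_mk]
    constructor
    · rintro ⟨x, ⟨s, hs, hx⟩, rfl⟩
      simp; omega
    · intro h
      refine ⟨(A 0, A 1), ⟨A 0 + A 1, by omega, rfl⟩, ?_⟩
      ext k
      fin_cases k <;> simp
  have card_T : T.card = (M + 2).choose 2 := by
    rw [hT, Finset.card_map, Finset.card_biUnion]
    · simp only [Finset.Nat.card_antidiagonal]
      have e1 : ∑ i ∈ Finset.range (M + 2), (i : ℕ) = ∑ i ∈ Finset.range (M + 1), (i + 1) + 0 :=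
        Finset.sum_range_succ' (fun i => i) (M + 1)
      rw [Nat.choose_two_right, ← Finset.sum_range_id]
      omega
    · intro s _ s' _ hss'
      exact Finset.disjoint_left.2 fun x hx hx' => hss' (by
        rw [Finset.HasAntidiagonal.mem_antidiagonal] at hx hx'
        omega)
  set G : Finset (Fin 2 → ℕ) := T.filter fun A => 4 ≤ A 0 + A 1 ∧ A ≠ ![5, 0] with hG
  have card_G : (M + 2).choose 2 ≤ G.card + 17 := by
    have hsub : T ⊆ G ∪ ((Finset.range 4 ×ˢ Finset.range 4).image
        (fun x : ℕ × ℕ => (![x.1, x.2] : Fin 2 → ℕ)) ∪ {![5, 0]}) := by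
      intro A hA
      rw [Finset.mem_union, Finset.mem_union, Finset.mem_singleton]
      by_cases h5 : A = ![5, 0]
      · exact Or.inr (Or.inr h5)
      · by_cases h4 : 4 ≤ A 0 + A 1
        · exact Or.inl (Finset.mem_filter.2 ⟨hA, h4, h5⟩)
        · refine Or.inr (Or.inl (Finset.mem_image.2 ⟨(A 0, A 1), ?_, ?_⟩))
          · rw [Finset.mem_product, Finset.mem_range, Finset.mem_range]; omega
          · ext k; fin_cases k <;> simp
    have h16 : ((Finset.range 4 ×ˢ Finset.range 4).image
        (fun x : ℕ × ℕ => (![x.1, x.2] : Fin 2 → ℕ)) ∪ {![5, 0]}).card ≤ 17 := by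
      refine (Finset.card_union_le _ _).trans ?_
      have hi : ((Finset.range 4 ×ˢ Finset.range 4).image
          (fun x : ℕ × ℕ => (![x.1, x.2] : Fin 2 → ℕ))).card ≤ 16 :=
        Finset.card_image_le.trans (by simp)
      rw [Finset.card_singleton]
      omega
    rw [← card_T]
    exact (Finset.card_le_card hsub).trans ((Finset.card_union_le _ _).trans (by omega))
  let e : (G → κ) → ((Fin 2 → ℕ) → κ) :=
    fun g A => if h : A ∈ G then g ⟨A, h⟩ else if A = ![5, 0] then 1 else 0
  have e_inj : Function.Injective e := by
    intro g₁ g₂ h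
    funext ⟨A, hA⟩
    simpa [e, hA] using congrFun h A
  have five_nmem : (![5, 0] : Fin 2 → ℕ) ∉ G := by simp [hG]
  have e_five : ∀ g, e g ![5, 0] = 1 := fun g => by simp [e, five_nmem]
  have e_ne : ∀ g A, e g A ≠ 0 → 4 ≤ A 0 + A 1 ∧ A 0 + A 1 ≤ M := by
    intro g A h
    have : A ∈ G ∨ A = ![5, 0] := by
      by_contra hcon
      push Not at hcon
      simp [e, hcon.1, hcon.2] at h
    rcases this with hA | rfl
    · exact ⟨(Finset.mem_filter.1 hA).2.1, (mem_T A).1 (Finset.mem_filter.1 hA).1⟩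
    · simpa using hM
  refine ⟨(Finset.univ : Finset (G → κ)).image e, fun c₀ hc => ?_, ?_⟩
  · obtain ⟨g, -, rfl⟩ := Finset.mem_image.1 hc
    refine ⟨fun A hA => ?_, word, fun _ _ => 0, fun m _ => multP_run _ (fun A hA => ?_) ?_ m⟩
    · by_contra hne
      have := (e_ne g A hne).2
      simp only [Fin.sum_univ_two] at hA
      omega
    · exact (e_ne g A fun h0 => hA (by rw [h0, map_zero])).1
    · rw [e_five, map_one]; exact one_ne_zero
  · rw [Finset.card_image_of_injective _ e_inj, Finset.card_univ, Fintype.card_fun,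
      Fintype.card_coe, ← pow_add]
    exact Nat.pow_le_pow_right Fintype.card_pos card_G

end Summit.ResolutionOfSingularities.ResolutionOfSingularities.Theorems.LinearCodimGrowth.Negative
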